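import Summits.Ventures.CertifiedArithmetic.LowPrec.RoundGrid

/-!
# Round-to-nearest-even into a minifloat format, with its correctness theorem

HONEST FRAMING (venture CertifiedArithmetic / cell `pub-lowprec`): certified error envelopes and
provably optimal rounding/accumulation schemes for low-precision formats under stated cost models;
every table by two implementations; no hardware or vendor claims.

`roundNE φ x : MiniFloat φ` is IEEE 754 roundTiesToEven of the rational `x` into the finite values
of `φ`, SATURATING: every `|x| ≥ maxRat` goes to `±top` (the OCP MX conversion rule "values
exceeding the representable range are clamped to the maximum, preserving the sign"
[RouhaniEtAl2023MX, §3]; IEEE overflow-to-∞ differs only for `|x| ≥ maxRat + ½ulp`, outside the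
finite value set that this development quantifies over). It is computed by integer arithmetic on
magnitudes in quanta (`rneInt`, `Format.rneGrid`), so it reduces in the kernel (`decide`) and
compiles (`#eval`) — no search over the value set.

Correctness (`round_correct` of the cell brief) is the conjunction of
* `roundNE_nearest : |x - (roundNE φ x).toRat| ≤ |x - y.toRat|` for every finite `y`;
* `roundNE_man_even_of_tie`: if some finite `y ≠ roundNE φ x` (as values) is equally near, the
  delivered trailing significand is even [IEEE7542019, §4.3.1] (for `m ≥ 1`; with `m = 0` every
  significand is even and the clause is void);
* `toRat_roundNE_toRat (y : MiniFloat φ) : (roundNE φ y.toRat).toRat = y.toRat` (projection);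
* `overflowNE φ x` records the IEEE pre-saturation overflow condition, separating the saturating
  policy (always `roundNE`) from the ∞/NaN policies (no finite result when the flag is set).
Consequences: the standard model `|x - fl x| ≤ u|x|` on the normal range and `≤ quantum/2` below it
[Higham2002ASNA, Thm 2.2 and §2.6], and `|fl x| = maxRat` for `|x| ≥ maxRat`.

Placement: venture development under `Summits/Ventures/CertifiedArithmetic/`; declarations are
dot-notation extensions of the Literature structures `Format` / `MiniFloat` and carry their
absolute `Literature.ComputerArithmetic.FloatingPoint.…` names (CONVENTIONS §2).
-/

namespace Literature.ComputerArithmetic.FloatingPoint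

/-! ### Rounding rationals into the format -/

/-- IEEE 754 roundTiesToEven of a rational into the finite values of `φ`, SATURATING at `±top`
(sign of the input kept; `0 ↦ +0`, negative inputs that round to zero give `-0`).
[cite: IEEE7542019, §4.3.1] -/
def roundNE (φ : Format) (x : ℚ) : MiniFloat φ :=
  MiniFloat.ofScaled φ (decide (x < 0)) (φ.rneGrid (|x| / φ.quantum))
    (Format.rneGrid_le_maxScaled _)

/-- Pre-saturation OVERFLOW flag of round-to-nearest-even: the RNE result on the grid with the
top binade's spacing continued upward (`Format.rneMult`) exceeds the largest finite magnitude —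
i.e. `|x|` lies above the IEEE threshold `maxRat + ½·ulp_top`, or AT it when the top significand
`2^m + topMan` is odd (the tie then goes to the even successor, which is out of range: `E5M2`,
binary16/32, bfloat16), but not at it when the top significand is even (`E4M3`: `464 ↦ 448`).
Under OCP `SAT` / P3109 `SatFinite` the delivered datum is `roundNE φ x` regardless of the flag;
under IEEE overflow-to-∞ (`E5M2`, binary formats) and OCP `E4M3` non-saturating mode (→ NaN) no
finite datum is delivered when the flag is set, and `roundNE φ x` is delivered otherwise.
[cite: IEEE7542019, §4.3.1 and §7.4] -/
def overflowNE (φ : Format) (x : ℚ) : Bool :=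
  decide (φ.maxScaled < φ.rneMult (|x| / φ.quantum))

namespace MiniFloat

variable {φ : Format}

/-- Without overflow, `roundNE` is the unsaturated grid rounding. [folklore] -/
theorem rneGrid_eq_rneMult_of_not_overflow {x : ℚ} (h : overflowNE φ x = false) :
    φ.rneGrid (|x| / φ.quantum) = φ.rneMult (|x| / φ.quantum) := by
  unfold overflowNE at h
  rw [Format.rneGrid_eq_min, min_eq_left (not_lt.mp (of_decide_eq_false h))]

/-- An overflowing input has magnitude at least `maxRat`. [folklore] -/
theorem maxRat_le_abs_of_overflow {x : ℚ} (h : overflowNE φ x = true) : φ.maxRat ≤ |x| := by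
  unfold overflowNE at h
  have h' := Format.maxScaled_le_of_clamp (φ := φ)
    (div_nonneg (abs_nonneg x) φ.quantum_pos.le) (of_decide_eq_true h)
  unfold Format.maxRat
  rwa [← le_div_iff₀ φ.quantum_pos]

/-- The scaled input `|x| / quantum` is nonnegative. [folklore] -/
theorem scaledInput_nonneg (x : ℚ) : 0 ≤ |x| / φ.quantum :=
  div_nonneg (abs_nonneg x) φ.quantum_pos.le

/-- Magnitude of the rounded datum. [folklore] -/
theorem scaledMag_roundNE (x : ℚ) :
    (roundNE φ x).scaledMag = φ.rneGrid (|x| / φ.quantum) := by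
  obtain ⟨_, k, j, hk, hkj⟩ :=
    representable_iff.mp (Format.rneGrid_representable (φ := φ) (scaledInput_nonneg x))
  exact scaledMag_ofScaled _ hk hkj

/-- Sign of the rounded datum is the sign of the input. [folklore] -/
@[simp] theorem neg_roundNE (x : ℚ) : (roundNE φ x).neg = decide (x < 0) := rfl

/-- Value of the rounded datum. [folklore] -/
theorem toRat_roundNE (x : ℚ) : (roundNE φ x).toRat =
    (if x < 0 then -((φ.rneGrid (|x| / φ.quantum) : ℕ) : ℚ) else (φ.rneGrid (|x| / φ.quantum) : ℕ))
      * φ.quantum := by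
  have h := scaledMag_roundNE (φ := φ) x
  unfold toRat toInt
  rw [h, neg_roundNE]
  by_cases hx : x < 0 <;> simp [hx]

/-- The rounding error in closed form: `|x - fl x| = |r - rneGrid r| · quantum` with
`r = |x| / quantum`. [folklore] -/
theorem abs_sub_roundNE (x : ℚ) : |x - (roundNE φ x).toRat| =
    |(|x| / φ.quantum) - (φ.rneGrid (|x| / φ.quantum) : ℕ)| * φ.quantum := by
  have hq := φ.quantum_pos
  rw [toRat_roundNE]
  rw [← abs_of_pos hq, ← abs_mul, abs_of_pos hq, sub_mul, div_mul_cancel₀ _ (ne_of_gt hq)]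
  by_cases hx : x < 0
  · rw [if_pos hx, abs_of_neg hx]
    rw [show x - -((φ.rneGrid (-x / φ.quantum)) : ℚ) * φ.quantum
        = -((-x) - (φ.rneGrid (-x / φ.quantum) : ℚ) * φ.quantum) by ring, abs_neg]
  · rw [if_neg hx, abs_of_nonneg (not_lt.mp hx)]

/-- ROUND_CORRECT, part 1 (nearest): no finite value of `φ` is closer to `x` than `roundNE φ x`.
[cite: IEEE7542019, §4.3.1] -/
theorem roundNE_nearest (x : ℚ) (y : MiniFloat φ) :
    |x - (roundNE φ x).toRat| ≤ |x - y.toRat| := by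
  have hq := φ.quantum_pos
  have hr := scaledInput_nonneg (φ := φ) x
  rw [abs_sub_roundNE]
  have h1 := Format.abs_sub_rneGrid_le hr y.representable_scaledMag
  calc |(|x| / φ.quantum) - (φ.rneGrid (|x| / φ.quantum) : ℕ)| * φ.quantum
      ≤ |(|x| / φ.quantum) - (y.scaledMag : ℚ)| * φ.quantum := mul_le_mul_of_nonneg_right h1 hq.le
    _ = abs (|x| - |y.toRat|) := by
        rw [abs_toRat, ← abs_of_pos hq, ← abs_mul, abs_of_pos hq, sub_mul,
          div_mul_cancel₀ _ (ne_of_gt hq)]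
    _ ≤ |x - y.toRat| := abs_abs_sub_abs_le_abs_sub x y.toRat

/-- `fl 0 = 0`. [folklore] -/
theorem toRat_roundNE_zero : (roundNE φ 0).toRat = 0 := by
  have h := roundNE_nearest (φ := φ) 0 (zero φ)
  rw [toRat_zero, sub_zero, abs_zero, zero_sub, abs_neg] at h
  exact abs_eq_zero.mp (le_antisymm h (abs_nonneg _))

/-- ROUND_CORRECT, part 2 (ties to even): if a finite `y`, different in value from `roundNE φ x`,
is equally near to `x`, then the delivered trailing significand is even (formats with `m ≥ 1`).
[cite: IEEE7542019, §4.3.1] -/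
theorem roundNE_man_even_of_tie (hm : 1 ≤ φ.manBits) {x : ℚ} {y : MiniFloat φ}
    (heq : |x - y.toRat| = |x - (roundNE φ x).toRat|) (hne : y.toRat ≠ (roundNE φ x).toRat) :
    2 ∣ (roundNE φ x).man := by
  have hq := φ.quantum_pos
  have hr := scaledInput_nonneg (φ := φ) x
  set r := |x| / φ.quantum with hr_def
  -- the tie descends to the grid
  have h1 := Format.abs_sub_rneGrid_le hr y.representable_scaledMag
  have hchain : |r - (y.scaledMag : ℚ)| * φ.quantum = abs (|x| - |y.toRat|) := by
    rw [abs_toRat, ← abs_of_pos hq, ← abs_mul, abs_of_pos hq, sub_mul, hr_def,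
      div_mul_cancel₀ _ (ne_of_gt hq)]
  have h3 := abs_abs_sub_abs_le_abs_sub x y.toRat
  have heq0 := heq
  rw [abs_sub_roundNE, ← hr_def] at heq
  have hgrid : |r - (y.scaledMag : ℚ)| = |r - (φ.rneGrid r : ℕ)| := by
    apply le_antisymm _ h1
    have : |r - (y.scaledMag : ℚ)| * φ.quantum ≤ |r - (φ.rneGrid r : ℕ)| * φ.quantum := by
      rw [hchain, ← heq]; exact h3
    exact le_of_mul_le_mul_right this hq
  -- the magnitudes differ (else y = -(roundNE x) ≠ 0 could not be equally near)
  have hne' : y.scaledMag ≠ φ.rneGrid r := by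
    intro hmag
    have hv : |y.toRat| = |(roundNE φ x).toRat| := by
      rw [abs_toRat, abs_toRat, scaledMag_roundNE, ← hr_def, hmag]
    rcases abs_eq_abs.mp hv with h | h
    · exact hne h
    · -- y = -(round x): tie forces x · round x = 0
      rw [h] at heq0 hne
      rcases abs_eq_abs.mp heq0 with h' | h'
      · apply hne; linarith
      · -- x = 0: then round x = +0 and y = -0 have equal values
        have hx : x = 0 := by linarith
        apply hne
        have h0 : (roundNE φ x).toRat = 0 := by subst hx; exact toRat_roundNE_zero
        rw [h0]; simp
  obtain ⟨hle, h2⟩ := Format.two_dvd_of_tie hr y.representable_scaledMag hgrid hne'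
  have hman : (roundNE φ x).man = φ.manOf (φ.rneMult r) := by
    show φ.manOf (φ.rneGrid (|x| / φ.quantum)) = _
    rw [← hr_def, Format.rneGrid_eq_min, min_eq_left hle]
  rw [hman]
  exact Format.two_dvd_manOf_rneMult hr hle h2 hm

/-- ROUND_CORRECT, part 3 (projection): finite values round to themselves (as values).
[cite: IEEE7542019, §4.3] -/
theorem toRat_roundNE_toRat (y : MiniFloat φ) : (roundNE φ y.toRat).toRat = y.toRat := by
  have h := roundNE_nearest (φ := φ) y.toRat y
  rw [sub_self, abs_zero] at h
  have := abs_eq_zero.mp (le_antisymm h (abs_nonneg _))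
  linarith

/-- SATURATION: every `|x| ≥ maxRat` rounds to magnitude `maxRat`. [cite: RouhaniEtAl2023MX, §3] -/
theorem abs_toRat_roundNE_of_maxRat_le {x : ℚ} (h : φ.maxRat ≤ |x|) :
    |(roundNE φ x).toRat| = φ.maxRat := by
  have hq := φ.quantum_pos
  have h' : (φ.maxScaled : ℚ) ≤ |x| / φ.quantum := by
    rw [le_div_iff₀ hq]; exact h
  rw [abs_toRat, scaledMag_roundNE, Format.rneGrid_eq_maxScaled_of_le h']
  rfl

/-- No overflow error within range: for `|x| ≤ maxRat` the rounding error is at most half the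
local spacing `2^s · quantum`. [folklore] -/
theorem abs_sub_roundNE_le_half_spacing {x : ℚ} (h : |x| ≤ φ.maxRat) :
    |x - (roundNE φ x).toRat| ≤ 2 ^ φ.shift ⌊|x| / φ.quantum⌋.toNat / 2 * φ.quantum := by
  have hq := φ.quantum_pos
  have hle : |x| / φ.quantum ≤ φ.maxScaled := by rw [div_le_iff₀ hq]; exact h
  rw [abs_sub_roundNE]
  exact mul_le_mul_of_nonneg_right
    (Format.abs_sub_rneGrid_le_half_spacing (scaledInput_nonneg x) hle) hq.le

/-- The unit roundoff as a fraction: `u = 1 / 2^(m+1)`. [folklore] -/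
theorem _root_.Literature.ComputerArithmetic.FloatingPoint.Format.unitRoundoff_eq (φ : Format) :
    φ.unitRoundoff = 1 / 2 ^ (φ.manBits + 1) := by
  unfold Format.unitRoundoff
  rw [show (-((φ.manBits : ℤ) + 1)) = -((φ.manBits + 1 : ℕ) : ℤ) by push_cast; ring, zpow_neg,
    zpow_natCast, one_div]

/-- STANDARD MODEL WITH GRADUAL UNDERFLOW: for `|x| ≤ maxRat`,
`|x - fl x| ≤ max (u · |x|) (quantum / 2)` — relative error `u` in the normal range, absolute
error half a quantum below it. [cite: Higham2002ASNA, Thm 2.2 and §2.6] -/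
theorem abs_sub_roundNE_le_max {x : ℚ} (h : |x| ≤ φ.maxRat) :
    |x - (roundNE φ x).toRat| ≤ max (φ.unitRoundoff * |x|) (φ.quantum / 2) := by
  have hq := φ.quantum_pos
  have h1 := abs_sub_roundNE_le_half_spacing h
  rcases Format.shift_floor_dichotomy (φ := φ) (scaledInput_nonneg x) with hs | hfloor
  · rw [hs, pow_zero] at h1
    exact le_trans (by linarith) (le_max_right _ _)
  · refine le_trans (le_trans h1 ?_) (le_max_left _ _)
    -- 2^s / 2 · q ≤ u |x| since 2^(m+s) ≤ |x| / q
    rw [Format.unitRoundoff_eq]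
    rw [le_div_iff₀ hq] at hfloor
    have e : (2 : ℚ) ^ φ.shift ⌊|x| / φ.quantum⌋.toNat / 2 * φ.quantum
        = 1 / 2 ^ (φ.manBits + 1) * (2 ^ (φ.manBits + φ.shift ⌊|x| / φ.quantum⌋.toNat) * φ.quantum)
        := by rw [pow_add, pow_succ]; field_simp; ring
    rw [e]
    exact mul_le_mul_of_nonneg_left hfloor (by positivity)

/-- STANDARD MODEL on the normal range: `2^m · quantum ≤ |x| ≤ maxRat` implies
`|x - fl x| ≤ u |x|`. [cite: Higham2002ASNA, Thm 2.2] -/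
theorem abs_sub_roundNE_le_unitRoundoff_mul {x : ℚ} (hlo : 2 ^ φ.manBits * φ.quantum ≤ |x|)
    (hhi : |x| ≤ φ.maxRat) : |x - (roundNE φ x).toRat| ≤ φ.unitRoundoff * |x| := by
  have hq := φ.quantum_pos
  refine le_trans (abs_sub_roundNE_le_max hhi) (max_le le_rfl ?_)
  rw [Format.unitRoundoff_eq]
  have : φ.quantum / 2 = 1 / 2 ^ (φ.manBits + 1) * (2 ^ φ.manBits * φ.quantum) := by
    rw [pow_succ]; field_simp
  rw [this]
  exact mul_le_mul_of_nonneg_left hlo (by positivity)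

/-- Below `2^(m+1) · quantum` (subnormals and the first normal binade, where the spacing is one
quantum) the error is at most half a quantum. [cite: Higham2002ASNA, §2.6] -/
theorem abs_sub_roundNE_le_half_quantum {x : ℚ} (hlt : |x| < 2 ^ (φ.manBits + 1) * φ.quantum)
    (hhi : |x| ≤ φ.maxRat) : |x - (roundNE φ x).toRat| ≤ φ.quantum / 2 := by
  have hq := φ.quantum_pos
  have h1 := abs_sub_roundNE_le_half_spacing hhi
  have hs : φ.shift ⌊|x| / φ.quantum⌋.toNat = 0 := by
    apply Format.shift_eq_zero_of_lt
    have : |x| / φ.quantum < ((2 ^ (φ.manBits + 1) : ℕ) : ℚ) := by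
      rw [div_lt_iff₀ hq]; push_cast; exact hlt
    have h0 : 0 ≤ ⌊|x| / φ.quantum⌋ := Int.floor_nonneg.mpr (scaledInput_nonneg x)
    have h2 : ⌊|x| / φ.quantum⌋ < ((2 ^ (φ.manBits + 1) : ℕ) : ℤ) :=
      Int.floor_lt.mpr (by exact_mod_cast this)
    omega
  rw [hs, pow_zero] at h1
  linarith

end MiniFloat

end Literature.ComputerArithmetic.FloatingPoint
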